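import Summits.Ventures.LatticeQCDFlow.Exactness.IMHModeRateSharp
import Summits.Ventures.LatticeQCDFlow.Scoring.ThinningSharp
import HarnessLib

/-!
# From a mode of the weight, flow-MCMC is a renewal: the exact law of the cold-started chain at every time

HONEST FRAMING: exact (Metropolis-corrected) sampling algorithms for lattice gauge theory;
figures of merit are autocorrelation/cost numbers at stated couplings and volumes; no
continuum-physics claim.

Venture `LatticeQCDFlow` (cell pub-lqcd), topic `Exactness`; FANOUT row 30 (lean-1, GEN-31).  NEW WORK of the
cell, general state space.  `Exactness/IMHKernel.lean` built the independence Metropolis–Hastings (flow-MCMC)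
kernel `K = indepMH q w` (proposal `q`, normalised weight `w = dπ/dq`, `π = w·q` a probability law);
`Exactness/IMHModeHolding.lean` / `IMHModeRateSharp.lean` (GEN-28) settled the cold start ON THE POINT `{x₀}`:
at a mode `x₀` of `w` the acceptance mass is exactly `1/w(x₀)` and `(K^t δ_{x₀})({x₀}) = (1 − 1/w(x₀))^t`.
Here the WHOLE LAW of the cold-started chain is computed, with no atom hypothesis:

* §1 **`indepMH_mode_eq`** — at a mode every proposal `y` is accepted with probability `w(y)/w(x₀)`, so ONE
  STEP FROM THE MODE IS EXACTLY THE MIXTURE `K(x₀, ·) = (1/w(x₀))·π + (1 − 1/w(x₀))·δ_{x₀}`: the accepted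
  move is an exact draw from the target (von Neumann rejection sampling with the envelope `π ≤ w(x₀)·q`, in
  kernel form); set-wise **`indepMH_mode_apply`**; the move part **`indepMH_mode_apply_diff`**
  (`K(x₀, B ∖ {x₀}) = π(B ∖ {x₀})/w(x₀)`) and the conditional form **`indepMH_mode_move_conditional`**
  (`K(x₀, B ∖ {x₀})·π({x₀}ᶜ) = K(x₀, {x₀}ᶜ)·π(B ∖ {x₀})`: GIVEN that the chain moves, where it moves to is
  `π` conditioned off the point).
* §2 **`iterate_bind_indepMH_mixture_mode_eq`** — the two-point family `(1 − λ)·π + λ·δ_{x₀}` is closed under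
  the chain: `λ ↦ λ·(1 − 1/w(x₀))` per step (`π` is invariant, `IMHKernel.indepMH_invariant`; additivity of
  `bind` from `Scoring/ThinningSharp.bind_add_measure` — the row of `K` AT `x₀` is the lazy kernel of
  `Scoring/DoeblinEnvelopeSharp`, the other rows are not); hence
  (**`iterate_bind_indepMH_dirac_mode_eq`**) THE COLD-STARTED CHAIN AT TIME `t` IS EXACTLY
  `δ_{x₀}K^t = (1 − r^t)·π + r^t·δ_{x₀}`, `r = 1 − 1/w(x₀)`: frozen with probability `r^t`, PERFECTLY
  EQUILIBRATED otherwise — nothing in between (general-space form of the finite-state formula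
  `Literature…MengersenTweedie.imh_lawAt_single_mode` [Wang2022IMH, Remark 1], for Mathlib `Kernel`s and
  arbitrary proposals).
* §3 **`iterate_bind_indepMH_dirac_mode_real_sub`** — for every measurable `B`:
  `δ_{x₀}K^t(B) − π(B) = r^t·(1_B(x₀) − π(B))` EXACTLY; so (**`iterate_bind_indepMH_dirac_mode_abs_le`**,
  **`iterate_bind_indepMH_dirac_mode_abs_eq_compl`**) `sup_B |δ_{x₀}K^t(B) − π(B)| = r^t·(1 − π{x₀})`,
  attained at `B = {x₀}ᶜ` — the exact total-variation distance for EVERY proposal (with an atom at `x₀` the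
  factor `1 − π{x₀}` replaces GEN-28's atom-free `1`).
* §4 **`integral_iterate_bind_indepMH_dirac_mode`** — EVERY OBSERVABLE RELAXES EXACTLY GEOMETRICALLY:
  `E_{x₀}[f(X_t)] = π(f) + r^t·(f(x₀) − π(f))` for every `π`-integrable `f`
  (**`integral_iterate_bind_indepMH_dirac_mode_sub`**).

Reading (for `Scaling/AutoregressiveGauge…`, where the cold configuration is the mode of both exact gauge
samplers' importance weights): the cold-started exact sampler is, until its first acceptance, a rejection
sampler producing ONE PERFECT draw from `π` at geometric cost with mean `w(cold) = c^{#B}M^k/Z`; after it the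
law is `π` forever; the bias of every observable (the plaquette included) from the cold start is exactly
`r^t·(f(cold) − π(f))`.  NOT CLAIMED: anything from a non-modal start (there the accepted move has law
`∝ min(w(x), w(y)) q(dy) ≠ π`); joint (two-time) laws.

No `sorry`, no new definitions, nothing cited as a fact; general measurable space with measurable singletons.
-/

noncomputable section

namespace Summit.Ventures.LatticeQCDFlow.Exactness

open MeasureTheory ProbabilityTheory Function
open scoped ENNReal

variable {Ω : Type*} [MeasurableSpace Ω] [MeasurableSingletonClass Ω]
variable {q : Measure Ω} [IsProbabilityMeasure q] {w : Ω → ℝ}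

/-! ## §1 One step from the mode is the mixture `(1/w(x₀))·π + (1 − 1/w(x₀))·δ_{x₀}` -/

omit [MeasurableSpace Ω] [MeasurableSingletonClass Ω] [IsProbabilityMeasure q] in
/-- At a mode the acceptance density is `w(y)/w(x₀) = (1/w(x₀))·w(y)` exactly. [ours] -/
theorem imhAcceptE_mode_eq (hw0 : ∀ y, 0 < w y) {x₀ : Ω} (hmax : ∀ y, w y ≤ w x₀) (y : Ω) :
    imhAcceptE w x₀ y = ENNReal.ofReal (w x₀)⁻¹ * ENNReal.ofReal (w y) := by
  unfold imhAcceptE imhAccept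
  rw [min_eq_right ((div_le_one (hw0 x₀)).2 (hmax y)), ← ENNReal.ofReal_mul (inv_nonneg.mpr (hw0 x₀).le),
    div_eq_inv_mul]

omit [MeasurableSingletonClass Ω] [IsProbabilityMeasure q] in
/-- At a mode of a normalised weight the acceptance mass is exactly `1/w(x₀)`. [ours] -/
theorem imhAcceptMass_mode_eq (hw0 : ∀ y, 0 < w y) {x₀ : Ω} (hmax : ∀ y, w y ≤ w x₀)
    [IsProbabilityMeasure (q.withDensity fun y => ENNReal.ofReal (w y))] :
    imhAcceptMass q w x₀ = ENNReal.ofReal (w x₀)⁻¹ := by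
  have h1 : (q.withDensity fun y => ENNReal.ofReal (w y)) Set.univ = 1 := measure_univ
  rw [withDensity_apply _ MeasurableSet.univ, Measure.restrict_univ] at h1
  rw [imhAcceptMass_eq_of_forall_le hw0 x₀ hmax, h1, mul_one]

omit [MeasurableSingletonClass Ω] in
/-- **ONE STEP FROM THE MODE, SET-WISE.**  `w` measurable, positive, normalised, maximal at `x₀`:
`K(x₀, B) = π(B)/w(x₀) + (1 − 1/w(x₀))·1_B(x₀)` for every measurable `B`. [ours] -/
theorem indepMH_mode_apply (hw : Measurable w) (hw0 : ∀ y, 0 < w y) {x₀ : Ω} (hmax : ∀ y, w y ≤ w x₀)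
    [IsProbabilityMeasure (q.withDensity fun y => ENNReal.ofReal (w y))] {B : Set Ω} (hB : MeasurableSet B) :
    indepMH q w x₀ B = ENNReal.ofReal (w x₀)⁻¹ * (q.withDensity fun y => ENNReal.ofReal (w y)) B +
      ENNReal.ofReal (1 - (w x₀)⁻¹) * B.indicator 1 x₀ := by
  have hW : 1 ≤ w x₀ := one_le_of_mode (q := q) hmax
  rw [indepMH_apply hw x₀ hB, imhAcceptMass_mode_eq hw0 hmax, withDensity_apply _ hB]
  simp_rw [imhAcceptE_mode_eq hw0 hmax]
  rw [lintegral_const_mul _ hw.ennreal_ofReal, ENNReal.ofReal_sub _ (inv_nonneg.mpr (hw0 x₀).le),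
    ENNReal.ofReal_one]

omit [MeasurableSingletonClass Ω] in
/-- **ONE STEP FROM THE MODE IS EXACTLY THE MIXTURE `(1/w(x₀))·π + (1 − 1/w(x₀))·δ_{x₀}`** (as measures): the
accepted move from a mode is an exact draw from the target — rejection sampling with the envelope
`π ≤ w(x₀)·q`, in kernel form. [ours] -/
theorem indepMH_mode_eq (hw : Measurable w) (hw0 : ∀ y, 0 < w y) {x₀ : Ω} (hmax : ∀ y, w y ≤ w x₀)
    [IsProbabilityMeasure (q.withDensity fun y => ENNReal.ofReal (w y))] :
    indepMH q w x₀ = ENNReal.ofReal (w x₀)⁻¹ • (q.withDensity fun y => ENNReal.ofReal (w y)) +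
      ENNReal.ofReal (1 - (w x₀)⁻¹) • Measure.dirac x₀ := by
  ext B hB
  rw [indepMH_mode_apply hw hw0 hmax hB, Measure.add_apply, Measure.smul_apply, Measure.smul_apply,
    smul_eq_mul, smul_eq_mul, Measure.dirac_apply' x₀ hB]

/-- **The move part**: `K(x₀, B ∖ {x₀}) = π(B ∖ {x₀})/w(x₀)` — off the point, one step from the mode is the
target scaled by the acceptance mass. [ours] -/
theorem indepMH_mode_apply_diff (hw : Measurable w) (hw0 : ∀ y, 0 < w y) {x₀ : Ω} (hmax : ∀ y, w y ≤ w x₀)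
    [IsProbabilityMeasure (q.withDensity fun y => ENNReal.ofReal (w y))] {B : Set Ω} (hB : MeasurableSet B) :
    indepMH q w x₀ (B \ {x₀}) = ENNReal.ofReal (w x₀)⁻¹ * (q.withDensity fun y => ENNReal.ofReal (w y)) (B \ {x₀}) := by
  rw [indepMH_mode_apply hw hw0 hmax (hB.diff (measurableSet_singleton x₀)),
    Set.indicator_of_notMem (fun h => h.2 (Set.mem_singleton x₀)), mul_zero, add_zero]

/-- The total move probability from the mode: `K(x₀, {x₀}ᶜ) = π({x₀}ᶜ)/w(x₀)`. [ours] -/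
theorem indepMH_mode_apply_compl (hw : Measurable w) (hw0 : ∀ y, 0 < w y) {x₀ : Ω} (hmax : ∀ y, w y ≤ w x₀)
    [IsProbabilityMeasure (q.withDensity fun y => ENNReal.ofReal (w y))] :
    indepMH q w x₀ {x₀}ᶜ = ENNReal.ofReal (w x₀)⁻¹ * (q.withDensity fun y => ENNReal.ofReal (w y)) {x₀}ᶜ := by
  rw [indepMH_mode_apply hw hw0 hmax (measurableSet_singleton x₀).compl,
    Set.indicator_of_notMem (by simp : x₀ ∉ ({x₀}ᶜ : Set Ω)), mul_zero, add_zero]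

/-- **GIVEN THAT IT MOVES, THE CHAIN MOVES TO AN EXACT DRAW FROM THE TARGET** (conditioned off the point):
`K(x₀, B ∖ {x₀})·π({x₀}ᶜ) = K(x₀, {x₀}ᶜ)·π(B ∖ {x₀})` for every measurable `B` (cross-multiplied form of
`K(x₀, · ∣ move) = π(· ∣ {x₀}ᶜ)`; for an atom-free proposal `π{x₀} = 0` and the conditioning is void). [ours] -/
theorem indepMH_mode_move_conditional (hw : Measurable w) (hw0 : ∀ y, 0 < w y) {x₀ : Ω}
    (hmax : ∀ y, w y ≤ w x₀) [IsProbabilityMeasure (q.withDensity fun y => ENNReal.ofReal (w y))]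
    {B : Set Ω} (hB : MeasurableSet B) :
    indepMH q w x₀ (B \ {x₀}) * (q.withDensity fun y => ENNReal.ofReal (w y)) {x₀}ᶜ =
      indepMH q w x₀ {x₀}ᶜ * (q.withDensity fun y => ENNReal.ofReal (w y)) (B \ {x₀}) := by
  rw [indepMH_mode_apply_diff hw hw0 hmax hB, indepMH_mode_apply_compl hw hw0 hmax]
  exact mul_right_comm _ _ _

/-! ## §2 The two-point family `(1 − λ)·π + λ·δ_{x₀}` is closed under the chain; the exact cold-start law -/

omit [MeasurableSingletonClass Ω] in
/-- One step of the chain on the two-point family: `((1 − λ)·π + λ·δ_{x₀})K = (1 − λr)·π + λr·δ_{x₀}`,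
`r = 1 − 1/w(x₀)`, for `0 ≤ λ ≤ 1`. [ours] -/
theorem bind_indepMH_mixture_mode_eq (hw : Measurable w) (hw0 : ∀ y, 0 < w y) {x₀ : Ω}
    (hmax : ∀ y, w y ≤ w x₀) [IsProbabilityMeasure (q.withDensity fun y => ENNReal.ofReal (w y))]
    {lam : ℝ} (hlam0 : 0 ≤ lam) (hlam1 : lam ≤ 1) :
    (ENNReal.ofReal (1 - lam) • (q.withDensity fun y => ENNReal.ofReal (w y)) +
        ENNReal.ofReal lam • Measure.dirac x₀).bind (indepMH q w) =
      ENNReal.ofReal (1 - lam * (1 - (w x₀)⁻¹)) • (q.withDensity fun y => ENNReal.ofReal (w y)) +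
        ENNReal.ofReal (lam * (1 - (w x₀)⁻¹)) • Measure.dirac x₀ := by
  haveI : Fact (Measurable w) := ⟨hw⟩
  have hW : 1 ≤ w x₀ := one_le_of_mode (q := q) hmax
  have ha0 : 0 ≤ (w x₀)⁻¹ := inv_nonneg.mpr (hw0 x₀).le
  have hr0 : 0 ≤ 1 - (w x₀)⁻¹ := sub_nonneg.2 (inv_le_one_of_one_le₀ hW)
  have hinv : (q.withDensity fun y => ENNReal.ofReal (w y)).bind (indepMH q w) =
      q.withDensity fun y => ENNReal.ofReal (w y) := (indepMH_invariant (q := q) hw hw0).def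
  rw [Summit.Ventures.LatticeQCDFlow.Scoring.bind_add_measure, Measure.bind_smul, Measure.bind_smul, hinv,
    Measure.dirac_bind (Kernel.measurable _), indepMH_mode_eq hw hw0 hmax, smul_add, smul_smul, smul_smul,
    ← add_assoc, ← add_smul, ← ENNReal.ofReal_mul hlam0, ← ENNReal.ofReal_mul hlam0,
    ← ENNReal.ofReal_add (sub_nonneg.2 hlam1) (mul_nonneg hlam0 ha0)]
  congr 2
  ring

omit [MeasurableSingletonClass Ω] in
/-- **THE TWO-POINT FAMILY IS CLOSED UNDER THE CHAIN**: started from `(1 − λ)·π + λ·δ_{x₀}` (`0 ≤ λ ≤ 1`), the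
law at time `t` is exactly `(1 − λr^t)·π + λr^t·δ_{x₀}`, `r = 1 − 1/w(x₀)`. [ours] -/
theorem iterate_bind_indepMH_mixture_mode_eq (hw : Measurable w) (hw0 : ∀ y, 0 < w y) {x₀ : Ω}
    (hmax : ∀ y, w y ≤ w x₀) [IsProbabilityMeasure (q.withDensity fun y => ENNReal.ofReal (w y))]
    {lam : ℝ} (hlam0 : 0 ≤ lam) (hlam1 : lam ≤ 1) (t : ℕ) :
    (fun m : Measure Ω => m.bind (indepMH q w))^[t]
        (ENNReal.ofReal (1 - lam) • (q.withDensity fun y => ENNReal.ofReal (w y)) +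
          ENNReal.ofReal lam • Measure.dirac x₀) =
      ENNReal.ofReal (1 - lam * (1 - (w x₀)⁻¹) ^ t) • (q.withDensity fun y => ENNReal.ofReal (w y)) +
        ENNReal.ofReal (lam * (1 - (w x₀)⁻¹) ^ t) • Measure.dirac x₀ := by
  have hW : 1 ≤ w x₀ := one_le_of_mode (q := q) hmax
  have hr0 : 0 ≤ 1 - (w x₀)⁻¹ := sub_nonneg.2 (inv_le_one_of_one_le₀ hW)
  have hr1 : 1 - (w x₀)⁻¹ ≤ 1 := sub_le_self _ (inv_nonneg.mpr (hw0 x₀).le)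
  induction t with
  | zero => simp
  | succ t ih =>
    have hl0 : 0 ≤ lam * (1 - (w x₀)⁻¹) ^ t := mul_nonneg hlam0 (pow_nonneg hr0 t)
    have hl1 : lam * (1 - (w x₀)⁻¹) ^ t ≤ 1 := mul_le_one₀ hlam1 (pow_nonneg hr0 t) (pow_le_one₀ hr0 hr1)
    rw [Function.iterate_succ_apply', ih, bind_indepMH_mixture_mode_eq hw hw0 hmax hl0 hl1, pow_succ,
      mul_assoc]

omit [MeasurableSingletonClass Ω] in
/-- **THE EXACT COLD-START LAW.**  `w` measurable, positive, normalised, maximal at `x₀`.  Started AT THE MODE,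
the flow-MCMC chain at time `t` is EXACTLY `δ_{x₀}K^t = (1 − r^t)·π + r^t·δ_{x₀}`, `r = 1 − 1/w(x₀)`: still
frozen with probability `r^t`, perfectly equilibrated otherwise. [ours] -/
theorem iterate_bind_indepMH_dirac_mode_eq (hw : Measurable w) (hw0 : ∀ y, 0 < w y) {x₀ : Ω}
    (hmax : ∀ y, w y ≤ w x₀) [IsProbabilityMeasure (q.withDensity fun y => ENNReal.ofReal (w y))] (t : ℕ) :
    (fun m : Measure Ω => m.bind (indepMH q w))^[t] (Measure.dirac x₀) =
      ENNReal.ofReal (1 - (1 - (w x₀)⁻¹) ^ t) • (q.withDensity fun y => ENNReal.ofReal (w y)) +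
        ENNReal.ofReal ((1 - (w x₀)⁻¹) ^ t) • Measure.dirac x₀ := by
  have h := iterate_bind_indepMH_mixture_mode_eq (q := q) hw hw0 hmax zero_le_one le_rfl t (x₀ := x₀)
  simp only [sub_self, ENNReal.ofReal_zero, zero_smul, zero_add, ENNReal.ofReal_one, one_smul, one_mul] at h
  exact h

/-! ## §3 Set-wise: the deviation from `π` is exactly `r^t·(1_B(x₀) − π(B))`; the exact total variation -/

omit [MeasurableSingletonClass Ω] in
/-- **Set-wise cold-start law**: `δ_{x₀}K^t(B) = (1 − r^t)·π(B) + r^t·1_B(x₀)`. [ours] -/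
theorem iterate_bind_indepMH_dirac_mode_real (hw : Measurable w) (hw0 : ∀ y, 0 < w y) {x₀ : Ω}
    (hmax : ∀ y, w y ≤ w x₀) [IsProbabilityMeasure (q.withDensity fun y => ENNReal.ofReal (w y))] (t : ℕ)
    {B : Set Ω} (hB : MeasurableSet B) :
    ((fun m : Measure Ω => m.bind (indepMH q w))^[t] (Measure.dirac x₀)).real B =
      (1 - (1 - (w x₀)⁻¹) ^ t) * (q.withDensity fun y => ENNReal.ofReal (w y)).real B +
        (1 - (w x₀)⁻¹) ^ t * B.indicator 1 x₀ := by
  have hW : 1 ≤ w x₀ := one_le_of_mode (q := q) hmax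
  have hr0 : 0 ≤ 1 - (w x₀)⁻¹ := sub_nonneg.2 (inv_le_one_of_one_le₀ hW)
  have hr1 : 1 - (w x₀)⁻¹ ≤ 1 := sub_le_self _ (inv_nonneg.mpr (hw0 x₀).le)
  have hc0 : 0 ≤ 1 - (1 - (w x₀)⁻¹) ^ t := sub_nonneg.2 (pow_le_one₀ hr0 hr1)
  rw [Measure.real, iterate_bind_indepMH_dirac_mode_eq hw hw0 hmax t, Measure.add_apply, Measure.smul_apply,
    Measure.smul_apply, smul_eq_mul, smul_eq_mul, Measure.dirac_apply' x₀ hB,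
    ENNReal.toReal_add (ENNReal.mul_ne_top ENNReal.ofReal_ne_top (measure_ne_top _ B))
      (ENNReal.mul_ne_top ENNReal.ofReal_ne_top (by
        by_cases hx : x₀ ∈ B
        · rw [Set.indicator_of_mem hx]; exact ENNReal.one_ne_top
        · rw [Set.indicator_of_notMem hx]; exact ENNReal.zero_ne_top)),
    ENNReal.toReal_mul, ENNReal.toReal_mul, ENNReal.toReal_ofReal hc0, ENNReal.toReal_ofReal (pow_nonneg hr0 t),
    Measure.real]
  congr 2
  by_cases hx : x₀ ∈ B
  · rw [Set.indicator_of_mem hx, Set.indicator_of_mem hx, Pi.one_apply, Pi.one_apply, ENNReal.toReal_one]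
  · rw [Set.indicator_of_notMem hx, Set.indicator_of_notMem hx, ENNReal.toReal_zero]

omit [MeasurableSingletonClass Ω] in
/-- **THE DEVIATION FROM THE TARGET IS EXACTLY `r^t·(1_B(x₀) − π(B))`** for every measurable `B`. [ours] -/
theorem iterate_bind_indepMH_dirac_mode_real_sub (hw : Measurable w) (hw0 : ∀ y, 0 < w y) {x₀ : Ω}
    (hmax : ∀ y, w y ≤ w x₀) [IsProbabilityMeasure (q.withDensity fun y => ENNReal.ofReal (w y))] (t : ℕ)
    {B : Set Ω} (hB : MeasurableSet B) :
    ((fun m : Measure Ω => m.bind (indepMH q w))^[t] (Measure.dirac x₀)).real B -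
        (q.withDensity fun y => ENNReal.ofReal (w y)).real B =
      (1 - (w x₀)⁻¹) ^ t * (B.indicator 1 x₀ - (q.withDensity fun y => ENNReal.ofReal (w y)).real B) := by
  rw [iterate_bind_indepMH_dirac_mode_real hw hw0 hmax t hB]
  ring

/-- **Exact total variation, upper half**: `|δ_{x₀}K^t(B) − π(B)| ≤ r^t·(1 − π{x₀})` for every measurable `B`
(no atom hypothesis: with an atom of `π` at `x₀` the chain is that much closer). [ours] -/
theorem iterate_bind_indepMH_dirac_mode_abs_le (hw : Measurable w) (hw0 : ∀ y, 0 < w y) {x₀ : Ω}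
    (hmax : ∀ y, w y ≤ w x₀) [IsProbabilityMeasure (q.withDensity fun y => ENNReal.ofReal (w y))] (t : ℕ)
    {B : Set Ω} (hB : MeasurableSet B) :
    |((fun m : Measure Ω => m.bind (indepMH q w))^[t] (Measure.dirac x₀)).real B -
        (q.withDensity fun y => ENNReal.ofReal (w y)).real B| ≤
      (1 - (w x₀)⁻¹) ^ t * (1 - (q.withDensity fun y => ENNReal.ofReal (w y)).real {x₀}) := by
  have hW : 1 ≤ w x₀ := one_le_of_mode (q := q) hmax
  have hr0 : 0 ≤ 1 - (w x₀)⁻¹ := sub_nonneg.2 (inv_le_one_of_one_le₀ hW)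
  set π : Measure Ω := q.withDensity fun y => ENNReal.ofReal (w y) with hπ
  rw [iterate_bind_indepMH_dirac_mode_real_sub hw hw0 hmax t hB, abs_mul, abs_of_nonneg (pow_nonneg hr0 t)]
  refine mul_le_mul_of_nonneg_left ?_ (pow_nonneg hr0 t)
  by_cases hx : x₀ ∈ B
  · rw [Set.indicator_of_mem hx, Pi.one_apply, abs_of_nonneg (sub_nonneg.2 measureReal_le_one)]
    exact sub_le_sub_left (measureReal_mono (Set.singleton_subset_iff.2 hx)) 1
  · rw [Set.indicator_of_notMem hx, zero_sub, abs_neg, abs_of_nonneg measureReal_nonneg]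
    have h1 : π.real B ≤ π.real {x₀}ᶜ := measureReal_mono (Set.subset_compl_singleton_iff.2 hx)
    have h2 : π.real {x₀}ᶜ = 1 - π.real {x₀} := by
      rw [measureReal_compl (measurableSet_singleton x₀), probReal_univ]
    linarith

/-- **… and it is attained at `B = {x₀}ᶜ`**: `|δ_{x₀}K^t({x₀}ᶜ) − π({x₀}ᶜ)| = r^t·(1 − π{x₀})` — the total
variation distance of the cold-started chain from the target at time `t` is EXACTLY `r^t·(1 − π{x₀})`. [ours] -/
theorem iterate_bind_indepMH_dirac_mode_abs_eq_compl (hw : Measurable w) (hw0 : ∀ y, 0 < w y) {x₀ : Ω}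
    (hmax : ∀ y, w y ≤ w x₀) [IsProbabilityMeasure (q.withDensity fun y => ENNReal.ofReal (w y))] (t : ℕ) :
    |((fun m : Measure Ω => m.bind (indepMH q w))^[t] (Measure.dirac x₀)).real {x₀}ᶜ -
        (q.withDensity fun y => ENNReal.ofReal (w y)).real {x₀}ᶜ| =
      (1 - (w x₀)⁻¹) ^ t * (1 - (q.withDensity fun y => ENNReal.ofReal (w y)).real {x₀}) := by
  have hW : 1 ≤ w x₀ := one_le_of_mode (q := q) hmax
  have hr0 : 0 ≤ 1 - (w x₀)⁻¹ := sub_nonneg.2 (inv_le_one_of_one_le₀ hW)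
  rw [iterate_bind_indepMH_dirac_mode_real_sub hw hw0 hmax t (measurableSet_singleton x₀).compl,
    Set.indicator_of_notMem (by simp : x₀ ∉ ({x₀}ᶜ : Set Ω)), zero_sub,
    measureReal_compl (measurableSet_singleton x₀), probReal_univ, abs_mul, abs_of_nonneg (pow_nonneg hr0 t),
    abs_neg, abs_of_nonneg (sub_nonneg.2 measureReal_le_one)]

/-- Atom-free proposal: the exact total variation is `r^t` on the nose (GEN-28's sharpness on `{x₀}`, now as the
deviation on the complement `{x₀}ᶜ`, i.e. on the event "the chain has moved"). [ours] -/
theorem iterate_bind_indepMH_dirac_mode_abs_eq_compl_of_null (hw : Measurable w) (hw0 : ∀ y, 0 < w y) {x₀ : Ω}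
    (hmax : ∀ y, w y ≤ w x₀) (hqx : q {x₀} = 0)
    [IsProbabilityMeasure (q.withDensity fun y => ENNReal.ofReal (w y))] (t : ℕ) :
    |((fun m : Measure Ω => m.bind (indepMH q w))^[t] (Measure.dirac x₀)).real {x₀}ᶜ -
        (q.withDensity fun y => ENNReal.ofReal (w y)).real {x₀}ᶜ| = (1 - (w x₀)⁻¹) ^ t := by
  rw [iterate_bind_indepMH_dirac_mode_abs_eq_compl hw hw0 hmax t, Measure.real,
    withDensity_singleton_eq_zero hqx, ENNReal.toReal_zero, sub_zero, mul_one]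

/-! ## §4 Every observable relaxes exactly geometrically from the cold start -/

/-- **THE EXACT LAW OF EVERY OBSERVABLE FROM THE COLD START**: for `π`-integrable `f`,
`E_{x₀}[f(X_t)] = (1 − r^t)·π(f) + r^t·f(x₀)`. [ours] -/
theorem integral_iterate_bind_indepMH_dirac_mode (hw : Measurable w) (hw0 : ∀ y, 0 < w y) {x₀ : Ω}
    (hmax : ∀ y, w y ≤ w x₀) [IsProbabilityMeasure (q.withDensity fun y => ENNReal.ofReal (w y))] (t : ℕ)
    {f : Ω → ℝ} (hf : Integrable f (q.withDensity fun y => ENNReal.ofReal (w y))) :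
    ∫ x, f x ∂((fun m : Measure Ω => m.bind (indepMH q w))^[t] (Measure.dirac x₀)) =
      (1 - (1 - (w x₀)⁻¹) ^ t) * ∫ x, f x ∂(q.withDensity fun y => ENNReal.ofReal (w y)) +
        (1 - (w x₀)⁻¹) ^ t * f x₀ := by
  have hW : 1 ≤ w x₀ := one_le_of_mode (q := q) hmax
  have hr0 : 0 ≤ 1 - (w x₀)⁻¹ := sub_nonneg.2 (inv_le_one_of_one_le₀ hW)
  have hr1 : 1 - (w x₀)⁻¹ ≤ 1 := sub_le_self _ (inv_nonneg.mpr (hw0 x₀).le)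
  have hc0 : 0 ≤ 1 - (1 - (w x₀)⁻¹) ^ t := sub_nonneg.2 (pow_le_one₀ hr0 hr1)
  have hfd : Integrable f (Measure.dirac x₀) := (integrable_const (f x₀)).congr (ae_eq_dirac f).symm
  rw [iterate_bind_indepMH_dirac_mode_eq hw hw0 hmax t,
    integral_add_measure (hf.smul_measure ENNReal.ofReal_ne_top) (hfd.smul_measure ENNReal.ofReal_ne_top),
    integral_smul_measure, integral_smul_measure, integral_dirac, ENNReal.toReal_ofReal hc0,
    ENNReal.toReal_ofReal (pow_nonneg hr0 t), smul_eq_mul, smul_eq_mul]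

/-- **EVERY OBSERVABLE RELAXES EXACTLY GEOMETRICALLY**: `E_{x₀}[f(X_t)] − π(f) = r^t·(f(x₀) − π(f))`,
`r = 1 − 1/w(x₀)` — the cold-start bias of every observable is its initial bias times the holding
probability. [ours] -/
theorem integral_iterate_bind_indepMH_dirac_mode_sub (hw : Measurable w) (hw0 : ∀ y, 0 < w y) {x₀ : Ω}
    (hmax : ∀ y, w y ≤ w x₀) [IsProbabilityMeasure (q.withDensity fun y => ENNReal.ofReal (w y))] (t : ℕ)
    {f : Ω → ℝ} (hf : Integrable f (q.withDensity fun y => ENNReal.ofReal (w y))) :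
    ∫ x, f x ∂((fun m : Measure Ω => m.bind (indepMH q w))^[t] (Measure.dirac x₀)) -
        ∫ x, f x ∂(q.withDensity fun y => ENNReal.ofReal (w y)) =
      (1 - (w x₀)⁻¹) ^ t * (f x₀ - ∫ x, f x ∂(q.withDensity fun y => ENNReal.ofReal (w y))) := by
  rw [integral_iterate_bind_indepMH_dirac_mode hw hw0 hmax t hf]
  ring

/-- The bias keeps its sign and is monotone in `t`: `|E_{x₀}[f(X_t)] − π(f)| = r^t·|f(x₀) − π(f)|`. [ours] -/
theorem abs_integral_iterate_bind_indepMH_dirac_mode_sub (hw : Measurable w) (hw0 : ∀ y, 0 < w y) {x₀ : Ω}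
    (hmax : ∀ y, w y ≤ w x₀) [IsProbabilityMeasure (q.withDensity fun y => ENNReal.ofReal (w y))] (t : ℕ)
    {f : Ω → ℝ} (hf : Integrable f (q.withDensity fun y => ENNReal.ofReal (w y))) :
    |∫ x, f x ∂((fun m : Measure Ω => m.bind (indepMH q w))^[t] (Measure.dirac x₀)) -
        ∫ x, f x ∂(q.withDensity fun y => ENNReal.ofReal (w y))| =
      (1 - (w x₀)⁻¹) ^ t * |f x₀ - ∫ x, f x ∂(q.withDensity fun y => ENNReal.ofReal (w y))| := by
  have hW : 1 ≤ w x₀ := one_le_of_mode (q := q) hmax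
  have hr0 : 0 ≤ 1 - (w x₀)⁻¹ := sub_nonneg.2 (inv_le_one_of_one_le₀ hW)
  rw [integral_iterate_bind_indepMH_dirac_mode_sub hw hw0 hmax t hf, abs_mul, abs_of_nonneg (pow_nonneg hr0 t)]

end Summit.Ventures.LatticeQCDFlow.Exactness
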